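import Summits.Ventures.Crystal3D.Kissing125.GSearchTransport
import Summits.Ventures.Crystal3D.Kissing125.GSearchDefs1
import HarnessLib

/-!
# Sides, growth and relabelling in the growth search, κ-generic — part 1/3

HONEST FRAMING (cell pub-crystal3d, K-path at `h = 5/4`, V4 = κ as an explicit parameter): this is NOT a result printed
by Hales; it is his METHOD (arXiv:1209.6043, Theorem 3 + Lemmas 7–10, in the tree's form of a verified interval-arithmetic
growth search, `Literature/…/KissingSearch*.lean`) with the largest long-side cosine `κ` made an EXPLICIT PARAMETER
(`κ : Kappa`, carrying the two numeric facts the soundness proof uses: `-1/2 ≤ κ`, `κ < 1/4`).  Only the declarations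
whose statement depends on `κ` are declared here (namespace `…Kissing125.GSearch`, the tree's short names, no renames);
every κ-free helper is the landed K25 copy (`…Kissing125.KissingSearch.*`) and every κ-free lemma is cited from the tree
(PRIVATE per-file citation aliases; `GSearchTransport.lean` holds `toT : St → tree St` and the transport equalities).  The K25
instance is `κ25 = ⟨7/32, …⟩`; `GSearchBridge.lean` identifies the generic checker at
`κ25` with the landed `Kissing125.KissingSearch.checkPart`, so the landed run files are consumed unchanged.  Generated by
`HOME/lean/kissing125/v4-prep/gen/mkgen.py`; nothing here is asserted about GAP(1.26) or any census.

THIS FILE: the κ-tainted declarations of `Literature/Geometry/DiscreteGeometry/KissingSearchRelabel.lean` (part 1 of 3), with `κ : Kappa` threaded; κ-free declarations of that file are NOT re-declared publicly (the κ-free helpers are the landed K25 copies; the κ-free tree lemmas used by the proofs are cited through PRIVATE aliases at the top of the file).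

## References
* T. C. Hales, *A proof of Fejes Tóth's conjecture on sphere packings with kissing number twelve*,
  arXiv:1209.6043 (2012): Definition 1, Theorem 2, Theorem 3, Lemmas 7–10. [`Hales2012`]
* R. E. Moore, *Interval Analysis* (1966), Theorem 3.1, §4.4. [`Moore1966`]
-/

namespace Summit.Ventures.Crystal3D.Kissing125

open Literature.Geometry.DiscreteGeometry
open Summit.Ventures.Crystal3D.Kissing125.KissingSearch

namespace GSearch

open Real Literature.Analysis.ValidatedNumerics KissingLP NonemptyInterval Finset

variable {κ : Kappa}

/-! ### κ-free tree lemmas used below, read over the K25 copies (PRIVATE citation aliases; the public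
surface of this file is κ-generic only) -/

/-- K25 reading of the tree lemma `cdeg_eq` (κ-free; proof = citation of the tree lemma). [folklore] -/
private theorem cdeg_eq (s : St) (v : ℕ) :
  s.cdeg v = (List.filter (fun u ↦ decide (u ≠ v ∧ s.gdom u v = 0)) (List.range' 0 12)).length :=
  by rw [cdeg_tr]; exact Literature.Geometry.DiscreteGeometry.KissingSearch.cdeg_eq (toT s) v

/-- K25 reading of the tree lemma `nlongAt_eq` (κ-free; proof = citation of the tree lemma). [folklore] -/
private theorem nlongAt_eq (s : St) (v : ℕ) :
  s.nlongAt v = (List.filter (fun u ↦ decide (u ≠ v ∧ s.gdom v u ≠ 0 ∧ s.gdom v u ≠ UNL)) (List.range' 0 12)).length :=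
  by rw [nlongAt_tr]; exact Literature.Geometry.DiscreteGeometry.KissingSearch.nlongAt_eq (toT s) v

/-- K25 reading of the tree lemma `nlong_eq` (κ-free; proof = citation of the tree lemma). [folklore] -/
private theorem nlong_eq (s : St) :
  s.nlong =
    (List.filter (fun i ↦ decide (i / 12 < i % 12 ∧ s.dom.getD i UNL ≠ 0 ∧ s.dom.getD i UNL ≠ UNL))
        (List.range' 0 144)).length :=
  by rw [nlong_tr]; exact Literature.Geometry.DiscreteGeometry.KissingSearch.nlong_eq (toT s)


/-! ### Part B. Counting sides -/

section Sides

variable (M : KConf κ)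

/-- Membership in `sides`. [folklore] -/
theorem KConf.mem_sides (M : KConf κ) {e : Finset ℕ} : e ∈ M.sides ↔ e.card = 2 ∧ ∃ t ∈ M.T, e ⊆ t := by
  unfold KConf.sides
  rw [Finset.mem_biUnion]
  constructor
  · rintro ⟨t, ht, he⟩
    rw [Finset.mem_powersetCard] at he
    exact ⟨he.2, t, ht, he.1⟩
  · rintro ⟨hc, t, ht, he⟩
    exact ⟨t, ht, Finset.mem_powersetCard.2 ⟨he, hc⟩⟩

/-- **The triangles have thirty sides** (`3 · 20 = 2 · 30`). [cite: Hales2012, proof of Theorem 3] -/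
theorem KConf.card_sides (M : KConf κ) : M.sides.card = 30 := by
  classical
  -- double counting of incidences
  have hinc : ∑ e ∈ M.sides, (M.T.filter fun t => e ⊆ t).card = ∑ t ∈ M.T, (M.sides.filter fun e => e ⊆ t).card := by
    simp only [Finset.card_eq_sum_ones, Finset.sum_filter]
    exact Finset.sum_comm
  have hleft : ∀ e ∈ M.sides, (M.T.filter fun t => e ⊆ t).card = 2 := by
    intro e he
    obtain ⟨hc, t, ht, het⟩ := (M.mem_sides).1 he
    obtain ⟨p, q, hpq, rfl⟩ := Finset.card_eq_two.1 hc
    have hp : p ∈ t := het (by simp)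
    have hq : q ∈ t := het (by simp)
    rw [← M.two t ht p hp q hq hpq]
    congr 1
    ext t'
    simp only [Finset.mem_filter, Finset.insert_subset_iff, Finset.singleton_subset_iff]
  have hright : ∀ t ∈ M.T, (M.sides.filter fun e => e ⊆ t).card = 3 := by
    intro t ht
    have : M.sides.filter (fun e => e ⊆ t) = t.powersetCard 2 := by
      ext e
      rw [Finset.mem_filter, M.mem_sides, Finset.mem_powersetCard]
      constructor
      · rintro ⟨⟨hc, -⟩, he⟩; exact ⟨he, hc⟩
      · rintro ⟨he, hc⟩; exact ⟨⟨hc, t, ht, he⟩, he⟩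
    rw [this, Finset.card_powersetCard, (M.mem_T t ht).1]
    rfl
  rw [Finset.sum_congr rfl hleft, Finset.sum_congr rfl hright, Finset.sum_const, Finset.sum_const, M.card_T] at hinc
  simp only [smul_eq_mul] at hinc
  omega

/-- **At most seven long sides** (at least `23` of the `30` sides are contacts).
[cite: Hales2012, Lemma 7 and proof of Theorem 3] -/
theorem KConf.card_longSides_le (M : KConf κ) : M.longSides.card ≤ 7 := by
  classical
  -- the contact pairs inject into the non-long sides
  set C := ((Finset.range 12) ×ˢ (Finset.range 12)).filter fun p => p.1 < p.2 ∧ M.g p.1 p.2 = 1 / 2 with hC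
  have hCcard := M.contacts_ge
  have himg : (C.image fun p => ({p.1, p.2} : Finset ℕ)) ⊆ M.sides.filter fun e => ¬ ∃ p ∈ e, ∃ q ∈ e, p ≠ q ∧ M.g p q ≠ 1 / 2 := by
    intro e he
    rw [Finset.mem_image] at he
    obtain ⟨p, hp, rfl⟩ := he
    rw [hC, Finset.mem_filter, Finset.mem_product, Finset.mem_range, Finset.mem_range] at hp
    obtain ⟨⟨h1, h2⟩, hlt, hg⟩ := hp
    obtain ⟨t, ht, hpt, hqt⟩ := M.contact_side _ _ h1 h2 (ne_of_lt hlt) hg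
    rw [Finset.mem_filter, M.mem_sides]
    refine ⟨⟨by rw [Finset.card_pair (ne_of_lt hlt)], t, ht, ?_⟩, ?_⟩
    · intro x hx; simp only [Finset.mem_insert, Finset.mem_singleton] at hx
      rcases hx with rfl | rfl
      · exact hpt
      · exact hqt
    · rintro ⟨x, hx, y, hy, hxy, hgxy⟩
      simp only [Finset.mem_insert, Finset.mem_singleton] at hx hy
      rcases hx with rfl | rfl <;> rcases hy with rfl | rfl
      · exact hxy rfl
      · exact hgxy hg
      · rw [M.g_symm] at hgxy; exact hgxy hg
      · exact hxy rfl
  have hinj : Set.InjOn (fun p : ℕ × ℕ => ({p.1, p.2} : Finset ℕ)) C := by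
    intro p hp p' hp' e
    rw [hC, Finset.mem_coe, Finset.mem_filter] at hp hp'
    simp only at e
    have h1 : p.1 ∈ ({p'.1, p'.2} : Finset ℕ) := by rw [← e]; simp
    have h2 : p.2 ∈ ({p'.1, p'.2} : Finset ℕ) := by rw [← e]; simp
    simp only [Finset.mem_insert, Finset.mem_singleton] at h1 h2
    have := hp.2.1; have := hp'.2.1
    exact Prod.ext (by omega) (by omega)
  have hcardimg : (C.image fun p => ({p.1, p.2} : Finset ℕ)).card = C.card := Finset.card_image_of_injOn hinj
  have hsplit := Finset.card_filter_add_card_filter_not (s := M.sides)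
    (p := fun e => ∃ p ∈ e, ∃ q ∈ e, p ≠ q ∧ M.g p q ≠ 1 / 2)
  rw [M.card_sides] at hsplit
  have h23 : 23 ≤ (M.sides.filter fun e => ¬ ∃ p ∈ e, ∃ q ∈ e, p ≠ q ∧ M.g p q ≠ 1 / 2).card :=
    le_trans hCcard (by rw [← hcardimg]; exact Finset.card_le_card himg)
  unfold KConf.longSides
  omega

end Sides

/-! ### Part C. Counting in a realized state; the growth step -/

section Grow

variable {M : KConf κ} {s : St}

/-- In a realized state `cdeg v ≤ 4`. [cite: Hales2012, Lemma 7] -/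
theorem cdeg_le_four {M : KConf κ} {s : St} (hR : Realizes M s) {v : ℕ} (hv : v < 12) : s.cdeg v ≤ 4 := by
  classical
  rw [cdeg_eq]
  refine le_trans ?_ (M.cdeg_le v hv)
  rw [← List.toFinset_card_of_nodup (List.Nodup.filter _ List.nodup_range')]
  apply Finset.card_le_card
  intro u hu
  rw [List.mem_toFinset, List.mem_filter, List.mem_range'_1] at hu
  simp only [decide_eq_true_eq] at hu
  obtain ⟨hu12, huv, h0⟩ := hu
  rw [Finset.mem_filter, Finset.mem_range]
  refine ⟨by omega, huv, ?_⟩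
  rcases hR.dom u v (by omega) hv huv with h | ⟨-, h⟩ | ⟨-, h, -⟩
  · rw [h0] at h; exact absurd h (by unfold UNL; norm_num)
  · rw [M.g_symm]; exact h
  · exact absurd h0 h

/-- In a realized state `nlong ≤ 7`. [cite: Hales2012, Lemma 7 and proof of Theorem 3] -/
theorem nlong_le_seven {M : KConf κ} {s : St} (hR : Realizes M s) : s.nlong ≤ 7 := by
  classical
  rw [nlong_eq]
  refine le_trans ?_ M.card_longSides_le
  rw [← List.toFinset_card_of_nodup (List.Nodup.filter _ List.nodup_range')]
  -- injection `i ↦ {i / 12, i % 12}`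
  refine Finset.card_le_card_of_injOn (fun i => ({i / 12, i % 12} : Finset ℕ)) ?_ ?_
  · intro i hi
    rw [Finset.mem_coe, List.mem_toFinset, List.mem_filter, List.mem_range'_1] at hi
    simp only [decide_eq_true_eq] at hi
    obtain ⟨hi144, hlt, h0, hU⟩ := hi
    set a := i / 12 with ha
    set b := i % 12 with hb
    have ha12 : a < 12 := by omega
    have hb12 : b < 12 := by omega
    have hab : a ≠ b := by omega
    have hidx : sIdx a b = i := by unfold sIdx; rw [if_pos hlt]; omega
    have hg : s.gdom a b = s.dom.getD i UNL := by unfold St.gdom; rw [hidx]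
    obtain ⟨t, ht, hat, hbt⟩ := hR.lab_side a b ha12 hb12 hab (by rw [hg]; exact hU)
    unfold KConf.longSides
    rw [Finset.mem_coe, Finset.mem_filter, M.mem_sides]
    refine ⟨⟨by rw [Finset.card_pair hab], tset t, hR.mem t ht, ?_⟩, a, Finset.mem_insert.2 (Or.inl ha), b,
      Finset.mem_insert_of_mem (Finset.mem_singleton.2 hb), hab, ?_⟩
    · intro x hx; simp only [Finset.mem_insert, Finset.mem_singleton] at hx
      rcases hx with rfl | rfl
      · exact hat
      · exact hbt
    · rcases hR.dom a b ha12 hb12 hab with h | ⟨h, -⟩ | ⟨-, -, h, -⟩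
      · rw [hg] at h; exact absurd h hU
      · rw [hg] at h; exact absurd h h0
      · exact h
  · intro i hi j hj e
    rw [Finset.mem_coe, List.mem_toFinset, List.mem_filter, List.mem_range'_1] at hi hj
    simp only [decide_eq_true_eq] at hi hj
    simp only at e
    have h1 : i / 12 ∈ ({j / 12, j % 12} : Finset ℕ) := by rw [← e]; simp
    have h2 : i % 12 ∈ ({j / 12, j % 12} : Finset ℕ) := by rw [← e]; simp
    simp only [Finset.mem_insert, Finset.mem_singleton] at h1 h2
    omega

/-- A labelled long side at `0` is a long side of `M` through `0`. [folklore] -/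
theorem longSide_of_label {M : KConf κ} {s : St} (hR : Realizes M s) {u : ℕ} (hu : u < 12) (hu0 : u ≠ 0)
    (h0 : s.gdom 0 u ≠ 0) (hU : s.gdom 0 u ≠ UNL) : ({0, u} : Finset ℕ) ∈ M.longSides := by
  obtain ⟨t, ht, h0t, hut⟩ := hR.lab_side 0 u (by norm_num) hu (Ne.symm hu0) hU
  unfold KConf.longSides
  rw [Finset.mem_filter, M.mem_sides]
  refine ⟨⟨by rw [Finset.card_pair (Ne.symm hu0)], tset t, hR.mem t ht, ?_⟩, 0, by simp, u, by simp, Ne.symm hu0, ?_⟩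
  · intro x hx; simp only [Finset.mem_insert, Finset.mem_singleton] at hx
    rcases hx with rfl | rfl
    · exact h0t
    · exact hut
  · rcases hR.dom 0 u (by norm_num) hu (Ne.symm hu0) with h | ⟨h, -⟩ | ⟨-, -, h, -⟩
    · exact absurd h hU
    · exact absurd h h0
    · exact h

/-- Under the root normalisation, at most one labelled long side at `0`. [folklore] -/
theorem nlongAt_zero_le_one {M : KConf κ} {s : St} (hR : Realizes M s) (hI : M.RootInv) : s.nlongAt 0 ≤ 1 := by
  rw [nlongAt_eq]
  by_contra h
  push Not at h
  set L := (List.range' 0 12).filter fun u => u ≠ 0 ∧ s.gdom 0 u ≠ 0 ∧ s.gdom 0 u ≠ UNL with hL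
  have hnd : L.Nodup := List.Nodup.filter _ List.nodup_range'
  obtain ⟨u, w, huw, hu, hw⟩ : ∃ u w, u ≠ w ∧ u ∈ L ∧ w ∈ L := by
    match L, h, hnd with
    | u :: w :: _, _, hnd =>
      refine ⟨u, w, ?_, by simp, by simp⟩
      rw [List.nodup_cons] at hnd
      exact fun e => hnd.1 (by rw [e]; simp)
  rw [hL] at hu hw
  simp only [List.mem_filter, List.mem_range'_1, decide_eq_true_eq] at hu hw
  have lu := longSide_of_label hR (by omega) hu.2.1 hu.2.2.1 hu.2.2.2
  have lw := longSide_of_label hR (by omega) hw.2.1 hw.2.2.1 hw.2.2.2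
  exact huw (hI.2.1 u w lu lw)

/-- The type read from a label agrees with the type in `M`. [folklore] -/
theorem ty_eq_of_label {M : KConf κ} {s : St} (hR : Realizes M s) {p q : ℕ} (hp : p < 12) (hq : q < 12) (hpq : p ≠ q)
    (hU : s.gdom p q ≠ UNL) : M.ty p q = if s.gdom p q = 0 then 0 else 1 := by
  unfold KConf.ty
  rcases hR.dom p q hp hq hpq with h | ⟨h, hg⟩ | ⟨-, h, hg, -⟩
  · exact absurd h hU
  · rw [if_pos hg, if_pos h]
  · rw [if_neg hg, if_neg h]

/-- Under the root normalisation, the tie-break never kills. [folklore] -/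
theorem tbKill_false {M : KConf κ} {s : St} (hR : Realizes M s) (hI : M.RootInv) : s.tbKill = false := by
  unfold St.tbKill
  simp only
  by_contra h
  rw [Bool.not_eq_false] at h
  simp only [Bool.and_eq_true, bne_iff_ne, ne_eq, Bool.or_eq_true, decide_eq_true_eq, beq_iff_eq] at h
  obtain ⟨⟨⟨⟨h03, h13⟩, h04⟩, h24⟩, hlex⟩ := h
  have e03 := ty_eq_of_label hR (by norm_num) (by norm_num) (by norm_num) h03
  have e13 := ty_eq_of_label hR (by norm_num) (by norm_num) (by norm_num) h13
  have e04 := ty_eq_of_label hR (by norm_num) (by norm_num) (by norm_num) h04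
  have e24 := ty_eq_of_label hR (by norm_num) (by norm_num) (by norm_num) h24
  apply hI.2.2
  rw [e03, e13, e04, e24]
  exact hlex

/-- **`countKill` is `false` on a realized state** under the root normalisation (labels `< 12`).
[folklore] -/
theorem countKill_false {M : KConf κ} {s : St} (hR : Realizes M s) (hI : M.RootInv) {v a c : ℕ} (hv : v < 12) (ha : a < 12) (hc : c < 12) :
    s.countKill v a c = false := by
  unfold St.countKill
  have h1 := cdeg_le_four hR hv
  have h2 := cdeg_le_four hR ha
  have h3 := cdeg_le_four hR hc
  have h4 := nlong_le_seven hR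
  have h5 := nlongAt_zero_le_one hR hI
  have h6 := tbKill_false hR hI
  simp only [Bool.or_eq_false_iff, decide_eq_false_iff_not, not_lt, h6]
  exact ⟨⟨⟨⟨⟨h1, h2⟩, h3⟩, h4⟩, h5⟩, trivial⟩

end Grow

end GSearch

end Summit.Ventures.Crystal3D.Kissing125
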